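import Summits.SmoothPoincare4.SmoothPoincare4.Theses.ConvexBisection
import Summits.SmoothPoincare4.SmoothPoincare4.Theses.GroupTrisection
import Summits.SmoothPoincare4.SmoothPoincare4.Theorems.ConvexBisectionContractibleTwistedDoubleStandardBisectionOrientable
import HarnessLib

/-!
# `ContractibleTwistedDoubleStandard` — the bet of line `property-r-mazur-halves` is a sector of the crux `GroupTrisection.GtriMorse1121`

Crux stmt-SmoothPoincare4-3546 (`Summit.SmoothPoincare4.SmoothPoincare4.Theses.ConvexBisection.ContractibleTwistedDoubleStandard`,
route ConvexBisection): a closed smooth `4`-manifold which is a Stein bisection along a common contact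
seam of two compact contractible Stein domains is `S⁴`.

Skeletons m7–m11 of the line `property-r-mazur-halves` (`Cruxes/ContractibleTwistedDoubleStandard/Lines/property_r_mazur_halves.lean`)
reduce the crux, on its Mazur × Mazur sector, to THE BET `stub_homotopySphereOneOneTwoOneOne`: a closed
smooth `X ≃ₕ S⁴` with a Morse function of profile `(1,1,2,1,1)` carries one of profile `(1,0,1,1,1)`
(SPC4 for that handle profile; twisted doubles of Mazur-type contractible `4`-manifolds are `S⁴`).  Six
leads recommended filing it as a new conjecture-class item.  It need not be filed: it is the
`(c₁, c₃) = (1, 1)` case of the EXISTING open crux item stmt-SmoothPoincare4-0435 of route `GroupTrisection`,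
`Summit.SmoothPoincare4.SmoothPoincare4.Theses.GroupTrisection.GtriMorse1121` (a closed smooth `M ≃ₕ S⁴` with a
Morse function having one minimum, `≤ 1` critical point of index `1`, `≤ 1` of index `3` and one maximum is
diffeomorphic to `S⁴`).  This file certifies the implication, sorry-free:

* `oneOneTwoOneOne_of_gtriMorse1121` — `GtriMorse1121 →` THE BET (registered helper stub of the crux item,
  signature = the two statements verbatim): 0435 gives `X ≅ S⁴`, and a manifold diffeomorphic to `S⁴` carries a
  `(1,0,1,1,1)` Morse function (`PropertyRMazurHalves.oneZeroOneOneOne_of_nonempty_diffeomorph_sphere`, p108569).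
* `gtriMorse1121_iff` — the registered stub `stub_gtriMorse1121` of skeleton m12 (the verbatim copy) is
  definitionally the route decl `GtriMorse1121` (`Iff.rfl`), so the skeleton's sector closes by `exact` the day
  item 0435 is proved.

The converse on this profile (bet ⇒ the `(1,1)` case of 0435) is `PropertyRMazurHalves.stub_closedOneZeroOne`
(p108247) modulo Laudenbach–Poénaru + Property R and the Morse equality `c₂ = c₁ + c₃`; the remaining cases of
0435 are Reeb–Cerf (`(0,0)`) and Property R (`(1,0)`, `(0,1)`).  Trisection reading (Meier–Schirmer–Zupan
arXiv:1507.06561 Prop. 4.2): homotopy `4`-spheres with a `(g; 1, g-2, 1)`-trisection; `g = 2` is MSZ Thm. 1.2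
(tree barrier `Literature.Barriers.SmoothPoincare4.LargeKTrisectionBarrier`), `g = 3` is the balanced
`(3;1,1,1)` of items stmt-SmoothPoincare4-0505/0507.  No new mathematics: bookkeeping that de-duplicates an
item for the planners.
-/

noncomputable section

set_option linter.dupNamespace false

open scoped Manifold ContDiff Topology ContinuousMap
open Set Function Literature.Topology.FourManifolds Literature.Geometry.Symplectic

namespace Summit.SmoothPoincare4.SmoothPoincare4.Theorems.ContractibleTwistedDoubleStandard.Negative

/-- **`GtriMorse1121` (item stmt-SmoothPoincare4-0435) ⇒ THE BET of line `property-r-mazur-halves`**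
(registered helper stub `oneOneTwoOneOne_of_gtriMorse1121`; hypothesis = the signature of 0435 verbatim,
conclusion = the registered bet `stub_homotopySphereOneOneTwoOneOne` verbatim): apply 0435 with
`c₁ = 1 ≤ 1`, `c₃ = 1 ≤ 1` to get `X ≅ S⁴`, then pull back the `(1,0,1,1,1)` function of `S⁴`
(`oneZeroOneOneOne_of_nonempty_diffeomorph_sphere`).  The index-`2` count is not used. [folklore] -/
theorem oneOneTwoOneOne_of_gtriMorse1121 :
    (∀ (M : Type) [TopologicalSpace M] [T2Space M] [SecondCountableTopology M]
      [ChartedSpace (EuclideanSpace ℝ (Fin 4)) M] [IsManifold (𝓡 4) ((⊤ : ℕ∞) : WithTop ℕ∞) M]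
      [CompactSpace M],
      M ≃ₕ Metric.sphere (0 : EuclideanSpace ℝ (Fin 5)) 1 →
      ∀ f : M → ℝ, Literature.Topology.FourManifolds.IsMorse (𝓡 4) f →
      (Literature.Topology.FourManifolds.criticalSetOfIndex (𝓡 4) f 0).ncard = 1 →
      (Literature.Topology.FourManifolds.criticalSetOfIndex (𝓡 4) f 1).ncard ≤ 1 →
      (Literature.Topology.FourManifolds.criticalSetOfIndex (𝓡 4) f 3).ncard ≤ 1 →
      (Literature.Topology.FourManifolds.criticalSetOfIndex (𝓡 4) f 4).ncard = 1 →
      Nonempty (Diffeomorph (𝓡 4) (𝓡 4) M (Metric.sphere (0 : EuclideanSpace ℝ (Fin 5)) 1)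
        ((⊤ : ℕ∞) : WithTop ℕ∞))) →
    ∀ (X : Type) [TopologicalSpace X] [T2Space X] [SecondCountableTopology X] [CompactSpace X]
      [ChartedSpace (EuclideanSpace ℝ (Fin 4)) X] [IsManifold (𝓡 4) ∞ X],
      X ≃ₕ Metric.sphere (0 : EuclideanSpace ℝ (Fin 5)) 1 →
      ∀ (F : X → ℝ), IsMorse (𝓡 4) F →
      (criticalSetOfIndex (𝓡 4) F 0).ncard = 1 → (criticalSetOfIndex (𝓡 4) F 1).ncard = 1 →
      (criticalSetOfIndex (𝓡 4) F 2).ncard = 2 → (criticalSetOfIndex (𝓡 4) F 3).ncard = 1 →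
      (criticalSetOfIndex (𝓡 4) F 4).ncard = 1 →
        ∃ F' : X → ℝ, IsMorse (𝓡 4) F' ∧
          (criticalSetOfIndex (𝓡 4) F' 0).ncard = 1 ∧ (criticalSetOfIndex (𝓡 4) F' 1).ncard = 0 ∧
          (criticalSetOfIndex (𝓡 4) F' 2).ncard = 1 ∧ (criticalSetOfIndex (𝓡 4) F' 3).ncard = 1 ∧
          (criticalSetOfIndex (𝓡 4) F' 4).ncard = 1 :=
  fun h X _ _ _ _ _ _ hX F hF c0 c1 _ c3 c4 =>
    PropertyRMazurHalves.oneZeroOneOneOne_of_nonempty_diffeomorph_sphere X (h X hX F hF c0 c1.le c3.le c4)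

/-- **The verbatim copy is the route decl**: the hypothesis of `oneOneTwoOneOne_of_gtriMorse1121` (= the
registered stub `stub_gtriMorse1121` of skeleton m12) is definitionally
`Summit.SmoothPoincare4.SmoothPoincare4.Theses.GroupTrisection.GtriMorse1121` (item stmt-SmoothPoincare4-0435).
[folklore] -/
theorem gtriMorse1121_iff :
    Summit.SmoothPoincare4.SmoothPoincare4.Theses.GroupTrisection.GtriMorse1121 ↔
    (∀ (M : Type) [TopologicalSpace M] [T2Space M] [SecondCountableTopology M]
      [ChartedSpace (EuclideanSpace ℝ (Fin 4)) M] [IsManifold (𝓡 4) ((⊤ : ℕ∞) : WithTop ℕ∞) M]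
      [CompactSpace M],
      M ≃ₕ Metric.sphere (0 : EuclideanSpace ℝ (Fin 5)) 1 →
      ∀ f : M → ℝ, Literature.Topology.FourManifolds.IsMorse (𝓡 4) f →
      (Literature.Topology.FourManifolds.criticalSetOfIndex (𝓡 4) f 0).ncard = 1 →
      (Literature.Topology.FourManifolds.criticalSetOfIndex (𝓡 4) f 1).ncard ≤ 1 →
      (Literature.Topology.FourManifolds.criticalSetOfIndex (𝓡 4) f 3).ncard ≤ 1 →
      (Literature.Topology.FourManifolds.criticalSetOfIndex (𝓡 4) f 4).ncard = 1 →
      Nonempty (Diffeomorph (𝓡 4) (𝓡 4) M (Metric.sphere (0 : EuclideanSpace ℝ (Fin 5)) 1)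
        ((⊤ : ℕ∞) : WithTop ℕ∞))) :=
  Iff.rfl

/-- **Corollary: item 0435 ⇒ THE BET**, with the hypothesis named. [folklore] -/
theorem oneOneTwoOneOne_of_gtriMorse1121' :
    Summit.SmoothPoincare4.SmoothPoincare4.Theses.GroupTrisection.GtriMorse1121 →
    ∀ (X : Type) [TopologicalSpace X] [T2Space X] [SecondCountableTopology X] [CompactSpace X]
      [ChartedSpace (EuclideanSpace ℝ (Fin 4)) X] [IsManifold (𝓡 4) ∞ X],
      X ≃ₕ Metric.sphere (0 : EuclideanSpace ℝ (Fin 5)) 1 →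
      ∀ (F : X → ℝ), IsMorse (𝓡 4) F →
      (criticalSetOfIndex (𝓡 4) F 0).ncard = 1 → (criticalSetOfIndex (𝓡 4) F 1).ncard = 1 →
      (criticalSetOfIndex (𝓡 4) F 2).ncard = 2 → (criticalSetOfIndex (𝓡 4) F 3).ncard = 1 →
      (criticalSetOfIndex (𝓡 4) F 4).ncard = 1 →
        ∃ F' : X → ℝ, IsMorse (𝓡 4) F' ∧
          (criticalSetOfIndex (𝓡 4) F' 0).ncard = 1 ∧ (criticalSetOfIndex (𝓡 4) F' 1).ncard = 0 ∧
          (criticalSetOfIndex (𝓡 4) F' 2).ncard = 1 ∧ (criticalSetOfIndex (𝓡 4) F' 3).ncard = 1 ∧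
          (criticalSetOfIndex (𝓡 4) F' 4).ncard = 1 :=
  fun h => oneOneTwoOneOne_of_gtriMorse1121 (gtriMorse1121_iff.1 h)

end Summit.SmoothPoincare4.SmoothPoincare4.Theorems.ContractibleTwistedDoubleStandard.Negative

end
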